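import Literature.NumberTheory.Sieve.FGKMT2018DkBoxClasses
import Mathlib.NumberTheory.Primorial
import HarnessLib

/-!
# FGKMT 2018 Theorem 6 / Maynard 2016 Props. 9.1–9.4: size of the error terms

Sources: J. Maynard, *Dense clusters of primes in subsets*, Compositio Math. 152 (2016) =
arXiv:1405.2593 [Maynard2016DenseClusters], proof of Proposition 9.1 p. 19 («the error
`∑_{d,e} |λ_d λ_e| max_a |#𝒜(x;q,a) − #𝒜(x)/q|` … by Lemma 8.5 … `λ_max² ≪ …`»), Lemma 8.5 p. 17;
K. Ford, B. Green, S. Konyagin, J. Maynard, T. Tao, *Long gaps between primes*, JAMS 31 (2018) =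
arXiv:1412.5029v4 [FordGreenKonyaginMaynardTao2018], §7 p. 21 (`W = ∏_{p ≤ 2k², p ∤ B} p`,
`k ≤ (log x)^{1/5}`, `x^{1/30}… ≤ R ≤ x^{1/9}`).

PROVED here (no named facts), for the pinned objects of `FGKMT2018MultidimensionalSieve`:

* `phiOmega_le_self` (`φ_ω(W) ≤ W` for squarefree `W`), `wCut_dvd_primorial`,
  `wCut_le_four_pow` (`W ≤ (2k²)# ≤ 4^{2k²}`), `phiOmega_wCut_le_four_pow`;
* `sum_abs_lamVar_F_le` — for `F = F_k`: `∑_{d ∈ 𝒟_k} |λ_d| ≤ Λ · R (1 + log R)^k` whenever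
  `|λ_d| ≤ Λ` on `𝒟_k` (`λ_d = 0` unless `∏ dᵢ < R`, and `#{d : ∏ dᵢ < R} ≤ R(1 + log R)^k`);
* **`prop91_error_le`** — the error of `abs_sum_sieveWt_sub_quadForm_le` is
  `≤ 4^{2k²} Λ² R² (1 + log R)^{2k}`;
* the growth facts of the regime `k ≤ (log x)^{1/5}`: `eventually_one_add_log_pow_le_rpow`
  (`(1 + log x)^{c k} ≤ x^ε`) and `eventually_four_pow_le_rpow` (`4^{2k²} ≤ x^ε`), so that the
  error is `≪ x^{3ε} R² ≤ x^{2/9 + 4ε}` against a main term of size `≍ x (log R)^k …`.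

## References
* J. Maynard, *Dense clusters of primes in subsets*, Compositio Math. 152 (2016), Lemma 8.5 and
  proof of Prop. 9.1 [Maynard2016DenseClusters].
* K. Ford, B. Green, S. Konyagin, J. Maynard, T. Tao, *Long gaps between primes*, JAMS 31 (2018),
  §7 [FordGreenKonyaginMaynardTao2018].
-/

noncomputable section

open Finset Filter Topology

namespace Literature.NumberTheory.Sieve.FGKMT2018

variable {k : ℕ}

/-! ### `φ_ω(W) ≤ W ≤ 4^{2k²}` -/

/-- `φ_ω(W) = ∏_{p ∣ W} (p − ω(p)) ≤ ∏_{p ∣ W} p = W` for squarefree `W`.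
[cite: Maynard2016DenseClusters, §7 p. 13 (φ_ω); proof of Prop. 9.1 p. 19] -/
theorem phiOmega_le_self (L : Fin k → ℤ × ℤ) {W : ℕ} (hW : Squarefree W) :
    phiOmega L W ≤ (W : ℝ) := by
  rw [← cast_prod_sub_omegaL]
  have h : ∏ p ∈ W.primeFactors, (p - omegaL L p) ≤ ∏ p ∈ W.primeFactors, p :=
    Finset.prod_le_prod (fun _ _ => Nat.zero_le _) fun p _ => Nat.sub_le p _
  rw [Nat.prod_primeFactors_of_squarefree hW] at h
  exact_mod_cast h

/-- `W = ∏_{p ≤ 2k², p ∤ B} p` divides the primorial `(2k²)#`.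
[cite: FordGreenKonyaginMaynardTao2018, §7 p. 21 (definition of W)] -/
theorem wCut_dvd_primorial (k B : ℕ) : wCut k B ∣ primorial (2 * k ^ 2) := by
  unfold wCut primorial
  refine Finset.prod_dvd_prod_of_subset _ _ _ fun p hp => ?_
  rcases Finset.mem_filter.1 hp with ⟨hpr, hpp, -⟩
  exact Finset.mem_filter.2 ⟨hpr, hpp⟩

/-- `W ≤ 4^{2k²}`. [cite: FordGreenKonyaginMaynardTao2018, §7 p. 21 (W = ∏_{p ≤ 2k², p ∤ B} p)] -/
theorem wCut_le_four_pow (k B : ℕ) : wCut k B ≤ 4 ^ (2 * k ^ 2) :=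
  (Nat.le_of_dvd (primorial_pos _) (wCut_dvd_primorial k B)).trans (primorial_le_four_pow _)

/-- `φ_ω(W) ≤ 4^{2k²}`. [cite: FordGreenKonyaginMaynardTao2018, §7 p. 21; Maynard2016DenseClusters, proof of Prop. 9.1 p. 19] -/
theorem phiOmega_wCut_le_four_pow (L : Fin k → ℤ × ℤ) (B : ℕ) :
    phiOmega L (wCut k B) ≤ (4 : ℝ) ^ (2 * k ^ 2) := by
  refine (phiOmega_le_self L (squarefree_wCut k B)).trans ?_
  exact_mod_cast wCut_le_four_pow k B

/-! ### `∑_d |λ_d| ≤ λ_max · #{d : ∏ dᵢ < R}` -/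

/-- For `F = F_k`: if `|λ_d| ≤ Λ` on `𝒟_k(𝓛)` then `∑_{d ∈ 𝒟_k} |λ_d| ≤ Λ R (1 + log R)^k`
(`λ_d = 0` unless `∏ dᵢ < R`; `#{d : ∏ dᵢ < R} ≤ R (1 + log R)^k`).
[cite: Maynard2016DenseClusters, Lemma 8.5 (iii) proof p. 17; proof of Prop. 9.1 p. 19] -/
theorem sum_abs_lamVar_F_le (L : Fin k → ℤ × ℤ) (B : ℕ) {R : ℝ} (hR : 1 < R) {Λ : ℝ} (hΛ0 : 0 ≤ Λ)
    (hΛ : ∀ d ∈ dkBox L B R, |lamVar L B R (MaynardDense.F k) d| ≤ Λ) :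
    ∑ d ∈ dkBox L B R, |lamVar L B R (MaynardDense.F k) d| ≤ Λ * (R * (1 + Real.log R) ^ k) := by
  classical
  have h1 : ∑ d ∈ dkBox L B R, |lamVar L B R (MaynardDense.F k) d| =
      ∑ d ∈ (dkBox L B R).filter (fun d => (∏ i, (d i : ℝ)) < R),
        |lamVar L B R (MaynardDense.F k) d| := by
    symm
    refine Finset.sum_filter_of_ne fun d _ hne => prod_lt_of_lamVar_F_ne_zero L B hR d ?_
    exact fun h0 => hne (by rw [h0, abs_zero])
  rw [h1]
  calc ∑ d ∈ (dkBox L B R).filter (fun d => (∏ i, (d i : ℝ)) < R), |lamVar L B R (MaynardDense.F k) d|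
      ≤ ∑ d ∈ (dkBox L B R).filter (fun d => (∏ i, (d i : ℝ)) < R), Λ :=
        Finset.sum_le_sum fun d hd => hΛ d (Finset.mem_filter.1 hd).1
    _ = Λ * #((dkBox L B R).filter fun d => (∏ i, (d i : ℝ)) < R) := by
        rw [Finset.sum_const, nsmul_eq_mul, mul_comm]
    _ ≤ Λ * (R * (1 + Real.log R) ^ k) :=
        mul_le_mul_of_nonneg_left (card_dkBox_filter_prod_lt_le L B hR.le) hΛ0

/-- **The error term of Proposition 9.1 for `𝒜 = ℤ`**: with `|λ_d| ≤ Λ` on `𝒟_k(𝓛)` (`F = F_k`),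
`φ_ω(W) (∑_d |λ_d|)² ≤ 4^{2k²} Λ² (R (1 + log R)^k)²`.
[cite: Maynard2016DenseClusters, proof of Prop. 9.1 p. 19 (error ≪ λ_max² …), Lemma 8.5 p. 17; FordGreenKonyaginMaynardTao2018, §7 p. 21] -/
theorem prop91_error_le (L : Fin k → ℤ × ℤ) (B : ℕ) {R : ℝ} (hR : 1 < R) {Λ : ℝ} (hΛ0 : 0 ≤ Λ)
    (hΛ : ∀ d ∈ dkBox L B R, |lamVar L B R (MaynardDense.F k) d| ≤ Λ) :
    phiOmega L (wCut k B) * (∑ d ∈ dkBox L B R, |lamVar L B R (MaynardDense.F k) d|) ^ 2 ≤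
      (4 : ℝ) ^ (2 * k ^ 2) * (Λ ^ 2 * (R * (1 + Real.log R) ^ k) ^ 2) := by
  have h1 := phiOmega_wCut_le_four_pow L B
  have h2 := sum_abs_lamVar_F_le L B hR hΛ0 hΛ
  have h0 : 0 ≤ ∑ d ∈ dkBox L B R, |lamVar L B R (MaynardDense.F k) d| :=
    Finset.sum_nonneg fun d _ => abs_nonneg _
  have h3 : (∑ d ∈ dkBox L B R, |lamVar L B R (MaynardDense.F k) d|) ^ 2 ≤
      Λ ^ 2 * (R * (1 + Real.log R) ^ k) ^ 2 := by
    rw [← mul_pow]; exact pow_le_pow_left₀ h0 h2 2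
  exact mul_le_mul h1 h3 (by positivity) (by positivity)

/-! ### Growth facts of the regime `k ≤ (log x)^{1/5}` -/

/-- In the regime `k ≤ (log x)^{1/5}`: for every fixed `c` and `ε > 0`, eventually
`(1 + log x)^{c k} ≤ x^ε` (so `(log R)^{O(k)}, λ_max² = x^{o(1)}`).
[cite: FordGreenKonyaginMaynardTao2018, §7 p. 21 (k ≤ (log x)^{1/5}); Maynard2016DenseClusters, proof of Prop. 9.1 p. 19] -/
theorem eventually_one_add_log_pow_le_rpow (c : ℕ) {ε : ℝ} (hε : 0 < ε) :
    ∀ᶠ x : ℕ in atTop, ∀ k : ℕ, (k : ℝ) ≤ Real.log x ^ ((1 : ℝ) / 5) →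
      (1 + Real.log x) ^ (c * k) ≤ (x : ℝ) ^ ε := by
  have hT : Tendsto (fun x : ℕ => Real.log x ^ ((3 : ℝ) / 5)) atTop atTop :=
    (tendsto_rpow_atTop (by norm_num)).comp (Real.tendsto_log_atTop.comp tendsto_natCast_atTop_atTop)
  filter_upwards [hT.eventually_ge_atTop (6 * c / ε), eventually_ge_atTop 3] with x hx hx3 k hk
  have hx3' : (3 : ℝ) ≤ x := by exact_mod_cast hx3
  have hx0 : (0 : ℝ) < x := by linarith
  set ℓ := Real.log (x : ℝ) with hℓ
  have hℓ1 : 1 ≤ ℓ := by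
    rw [hℓ, Real.le_log_iff_exp_le (by linarith)]
    exact (Real.exp_one_lt_d9.le.trans (by norm_num)).trans hx3'
  have hℓ0 : 0 ≤ ℓ := zero_le_one.trans hℓ1
  -- log ℓ ≤ 5 ℓ^{1/5}
  have h15 : Real.log ℓ ≤ 5 * ℓ ^ ((1 : ℝ) / 5) := by
    have h := Real.log_le_rpow_div hℓ0 (by norm_num : (0 : ℝ) < 1 / 5)
    rw [div_eq_mul_inv, show ((1 : ℝ) / 5)⁻¹ = 5 by norm_num] at h
    linarith
  have hrp1 : 1 ≤ ℓ ^ ((1 : ℝ) / 5) := Real.one_le_rpow hℓ1 (by norm_num)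
  have hlog1ℓ : Real.log (1 + ℓ) ≤ 6 * ℓ ^ ((1 : ℝ) / 5) := by
    calc Real.log (1 + ℓ) ≤ Real.log (2 * ℓ) := Real.log_le_log (by linarith) (by linarith)
      _ = Real.log 2 + Real.log ℓ := Real.log_mul (by norm_num) (by linarith)
      _ ≤ 6 * ℓ ^ ((1 : ℝ) / 5) := by linarith [Real.log_two_lt_d9]
  have h25 : ℓ ^ ((1 : ℝ) / 5) * ℓ ^ ((1 : ℝ) / 5) = ℓ ^ ((2 : ℝ) / 5) := by
    rw [← Real.rpow_add' hℓ0 (by norm_num)]; norm_num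
  have h35 : ℓ ^ ((3 : ℝ) / 5) * ℓ ^ ((2 : ℝ) / 5) = ℓ := by
    rw [← Real.rpow_add' hℓ0 (by norm_num)]; norm_num
  have hx' : (6 * c : ℝ) ≤ ε * ℓ ^ ((3 : ℝ) / 5) := by
    rw [div_le_iff₀ hε] at hx; linarith
  have hexp : ((c * k : ℕ) : ℝ) * Real.log (1 + ℓ) ≤ ε * ℓ := by
    have hlogpos : 0 ≤ Real.log (1 + ℓ) := Real.log_nonneg (by linarith)
    push_cast
    calc (c : ℝ) * k * Real.log (1 + ℓ)
        ≤ (c : ℝ) * ℓ ^ ((1 : ℝ) / 5) * (6 * ℓ ^ ((1 : ℝ) / 5)) :=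
          mul_le_mul (mul_le_mul_of_nonneg_left hk (Nat.cast_nonneg c)) hlog1ℓ hlogpos
            (by positivity)
      _ = 6 * c * (ℓ ^ ((1 : ℝ) / 5) * ℓ ^ ((1 : ℝ) / 5)) := by ring
      _ = 6 * c * ℓ ^ ((2 : ℝ) / 5) := by rw [h25]
      _ ≤ ε * ℓ ^ ((3 : ℝ) / 5) * ℓ ^ ((2 : ℝ) / 5) := mul_le_mul_of_nonneg_right hx' (by positivity)
      _ = ε * ℓ := by rw [mul_assoc, h35]
  have lhs : ((1 + ℓ) ^ (c * k) : ℝ) = Real.exp (((c * k : ℕ) : ℝ) * Real.log (1 + ℓ)) := by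
    rw [← Real.rpow_natCast, Real.rpow_def_of_pos (by linarith), mul_comm]
  have rhs : (x : ℝ) ^ ε = Real.exp (ε * ℓ) := by
    rw [Real.rpow_def_of_pos hx0, mul_comm]
  rw [lhs, rhs]
  exact Real.exp_le_exp.2 hexp

/-- In the regime `k ≤ (log x)^{1/5}`: for every `ε > 0`, eventually `4^{2k²} ≤ x^ε` (so
`W, φ_ω(W) = x^{o(1)}`). [cite: FordGreenKonyaginMaynardTao2018, §7 p. 21 (W ≤ ∏_{p ≤ 2k²} p, k ≤ (log x)^{1/5})] -/
theorem eventually_four_pow_le_rpow {ε : ℝ} (hε : 0 < ε) :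
    ∀ᶠ x : ℕ in atTop, ∀ k : ℕ, (k : ℝ) ≤ Real.log x ^ ((1 : ℝ) / 5) →
      (4 : ℝ) ^ (2 * k ^ 2) ≤ (x : ℝ) ^ ε := by
  have hT : Tendsto (fun x : ℕ => Real.log x ^ ((3 : ℝ) / 5)) atTop atTop :=
    (tendsto_rpow_atTop (by norm_num)).comp (Real.tendsto_log_atTop.comp tendsto_natCast_atTop_atTop)
  filter_upwards [hT.eventually_ge_atTop (6 / ε), eventually_ge_atTop 3] with x hx hx3 k hk
  have hx3' : (3 : ℝ) ≤ x := by exact_mod_cast hx3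
  have hx0 : (0 : ℝ) < x := by linarith
  set ℓ := Real.log (x : ℝ) with hℓ
  have hℓ1 : 1 ≤ ℓ := by
    rw [hℓ, Real.le_log_iff_exp_le (by linarith)]
    exact (Real.exp_one_lt_d9.le.trans (by norm_num)).trans hx3'
  have hℓ0 : 0 ≤ ℓ := zero_le_one.trans hℓ1
  have hk2 : (k : ℝ) ^ 2 ≤ ℓ ^ ((2 : ℝ) / 5) := by
    have h := pow_le_pow_left₀ (Nat.cast_nonneg k) hk 2
    rw [← Real.rpow_natCast (ℓ ^ ((1 : ℝ) / 5)) 2, ← Real.rpow_mul hℓ0] at h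
    norm_num at h
    exact h
  have h35 : ℓ ^ ((3 : ℝ) / 5) * ℓ ^ ((2 : ℝ) / 5) = ℓ := by
    rw [← Real.rpow_add' hℓ0 (by norm_num)]; norm_num
  have hx' : (6 : ℝ) ≤ ε * ℓ ^ ((3 : ℝ) / 5) := by
    rw [div_le_iff₀ hε] at hx; linarith
  have hlog4 : Real.log 4 ≤ 3 := by
    have := Real.log_le_sub_one_of_pos (by norm_num : (0 : ℝ) < 4); linarith
  have hexp : ((2 * k ^ 2 : ℕ) : ℝ) * Real.log 4 ≤ ε * ℓ := by
    push_cast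
    have hlog4' : 0 ≤ Real.log 4 := Real.log_nonneg (by norm_num)
    calc (2 : ℝ) * (k : ℝ) ^ 2 * Real.log 4 ≤ 2 * ℓ ^ ((2 : ℝ) / 5) * 3 :=
          mul_le_mul (by linarith) hlog4 hlog4' (by positivity)
      _ = 6 * ℓ ^ ((2 : ℝ) / 5) := by ring
      _ ≤ ε * ℓ ^ ((3 : ℝ) / 5) * ℓ ^ ((2 : ℝ) / 5) := mul_le_mul_of_nonneg_right hx' (by positivity)
      _ = ε * ℓ := by rw [mul_assoc, h35]
  have lhs : ((4 : ℝ) ^ (2 * k ^ 2)) = Real.exp (((2 * k ^ 2 : ℕ) : ℝ) * Real.log 4) := by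
    rw [← Real.rpow_natCast, Real.rpow_def_of_pos (by norm_num), mul_comm]
  have rhs : (x : ℝ) ^ ε = Real.exp (ε * ℓ) := by
    rw [Real.rpow_def_of_pos hx0, mul_comm]
  rw [lhs, rhs]
  exact Real.exp_le_exp.2 hexp

end Literature.NumberTheory.Sieve.FGKMT2018
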